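import Summits.AtomisticToContinuum.BoseEinsteinCondensation.Theorems.BECGroundStateSOSPeriodicIRBoundDefs
import Summits.AtomisticToContinuum.BoseEinsteinCondensation.Theorems.BECGroundStateSOSPeriodicIRBoundWFDefs
import Literature.MathematicalPhysics.QuantumManyBody.PeriodicBoseGasMomentumSector
import Literature.MathematicalPhysics.QuantumManyBody.PeriodicConfigFourier
import Literature.MathematicalPhysics.QuantumManyBody.CouplingPathSliceFloor
import HarnessLib

/-! # Crux `PeriodicIRBound` (stmt-AtomisticToContinuum-3972), line `linear-ph-floor-wagner`, stub 5b `stub_wagnerFeynman` — Variational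
A: variational principles for unnormalised core functions (`E₀‖f‖² ≤ 𝓔[f]`, sector version, `E₀(M) ≤ E₀(M+1)`); H: Minkowski for `‖·‖²`, the real-arithmetic core and the slack choice of the assembly. -/

/-!

* `groundStateEnergy_mul_normSq_le` (A1): `E₀(M,L) · ‖f‖² ≤ 𝓔_w[f]` for every core `f`
  (`C¹`, `Lℤ³`-periodic, Bose-symmetric, NOT normalised) — this is the tree's scaling inequality
  `BoseGas.periodicGroundStateEnergy_mul_normSq_le` (`CouplingPathSliceFloor.lean`), whose two sides
  are `normSq`/`qform` definitionally.
* `momentumSectorEnergy_mul_normSq_le` (A2): the same in a total-momentum sector,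
  `E_M(q) · ‖f‖² ≤ 𝓔_w[f]` for cores `f` of total momentum `q`: normalise with
  `PeriodicTrialState.ofFun` (`IsCore.toTrialState`), the sector is stable under scalars
  (`HasTotalMomentum.ofFun`), energies and masses scale with `|c|²` (`qform_const_mul`,
  `normSq_const_mul`), `momentumSectorEnergy_le`; the common normalisation step is
  `mul_normSq_le_qform_of_forall_le`.
* `periodicGroundStateEnergy_le_succ` (A3): `E₀(M,L) ≤ E₀(M+1,L)` for measurable `w ≥ 0` — freeze
  particle `0`: the tree's slice floor `periodicGroundStateEnergy_le_coupledGroundStateEnergy_zero`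
  (`E₀(M) ≤ E_{λ=0}(M)`: the slices `Y ↦ Ψ(x₀, Y)` of an `(M+1)`-body state are unnormalised `M`-body
  cores whose kinetic density is the bath part of `|∇Ψ|²`, Tonelli over `x₀`, drop `|∇₀Ψ|²`) followed by
  `coupledGroundStateEnergy_le_periodic` (`E_λ(M) ≤ E₀(M+1)`: `u_0 = 0 ≤ v` drops the pairs through
  particle `0`, and a Bose-symmetric state is a tagged state).

Design: the hypotheses `0 < L` (A1–A3) and `Measurable w` (A1) of the plan's statements are not
needed by these proofs; they are kept (binder names `_hL`, `_hw`) so that the positional signatures of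
the plan are unchanged. Imports: `CouplingPathSliceFloor` (adds itself and `PeriodicBoseGasCouplingPath`
to the closure of the plan's imports) and `PeriodicConfigFourier` (`IsTorusPeriodic`).
-/

noncomputable section

open scoped BigOperators ENNReal ComplexConjugate
open Filter MeasureTheory

namespace Summit.AtomisticToContinuum.BoseEinsteinCondensation.Cruxes.PeriodicIRBound.LinearPhFloorWagner.WF

open Literature.MathematicalPhysics.QuantumManyBody.BoseGas

variable {M : ℕ} {L : ℝ}

/-! ## Finiteness and scaling of `‖·‖²` and `𝓔_w` -/

/-- A continuous function has finite mass on the (bounded) fundamental cell: `‖f‖² < ∞`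
(`BoseGas.lintegral_cellN_normSq_ne_top`). [folklore] -/
theorem normSq_lt_top (L : ℝ) {f : Config M → ℂ} (hf : Continuous f) : normSq L f < ⊤ :=
  (lintegral_cellN_normSq_ne_top hf L).lt_top

/-- `|∇(c f)|² = |c|² |∇f|²` pointwise, for a complex constant `c` and differentiable `f`. [folklore] -/
theorem kineticDensity_const_mul_wf (c : ℂ) {f : Config M → ℂ} (hf : Differentiable ℝ f)
    (X : Config M) :
    kineticDensity (fun Y => c * f Y) X = (‖c‖₊ : ℝ≥0∞) ^ 2 * kineticDensity f X := by
  unfold kineticDensity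
  rw [Finset.mul_sum]
  refine Finset.sum_congr rfl fun i _ => ?_
  rw [Finset.mul_sum]
  refine Finset.sum_congr rfl fun a _ => ?_
  rw [fderiv_const_mul (hf X), _root_.smul_apply, smul_eq_mul, nnnorm_mul,
    ENNReal.coe_mul, mul_pow]

/-- The form scales quadratically: `𝓔_w[c f] = |c|² 𝓔_w[f]` (differentiable `f`). [folklore] -/
theorem qform_const_mul (w : ℝ → ℝ≥0∞) (L : ℝ) (c : ℂ) {f : Config M → ℂ}
    (hf : Differentiable ℝ f) :
    qform w L (fun X => c * f X) = (‖c‖₊ : ℝ≥0∞) ^ 2 * qform w L f := by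
  unfold qform
  rw [← lintegral_const_mul' _ _ (ENNReal.pow_ne_top ENNReal.coe_ne_top)]
  refine lintegral_congr fun X => ?_
  rw [kineticDensity_const_mul_wf c hf, nnnorm_mul, ENNReal.coe_mul, mul_pow, mul_add]
  ring

/-- The mass scales quadratically: `‖c f‖² = |c|² ‖f‖²`. [folklore] -/
theorem normSq_const_mul (L : ℝ) (c : ℂ) (f : Config M → ℂ) :
    normSq L (fun X => c * f X) = (‖c‖₊ : ℝ≥0∞) ^ 2 * normSq L f := by
  unfold normSq
  rw [← lintegral_const_mul' _ _ (ENNReal.pow_ne_top ENNReal.coe_ne_top)]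
  refine lintegral_congr fun X => ?_
  rw [nnnorm_mul, ENNReal.coe_mul, mul_pow]

/-- The normalised state `f/‖f‖` of a core `f` with `0 < ‖f‖² < ∞` (`PeriodicTrialState.ofFun`). [folklore] -/
def IsCore.toTrialState {f : Config M → ℂ} (hf : IsCore L f) (h0 : normSq L f ≠ 0)
    (htop : normSq L f ≠ ⊤) : PeriodicTrialState M L :=
  PeriodicTrialState.ofFun f hf.contDiff hf.periodic hf.symm h0 htop

/-- The wave function of `f/‖f‖` is `‖f‖⁻¹ · f`. [folklore] -/
theorem IsCore.toTrialState_ψ {f : Config M → ℂ} (hf : IsCore L f) (h0 : normSq L f ≠ 0)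
    (htop : normSq L f ≠ ⊤) :
    (hf.toTrialState h0 htop).ψ = fun X => ((Real.sqrt (normSq L f).toReal)⁻¹ : ℂ) * f X :=
  rfl

/-- The energy of `f/‖f‖` is `𝓔_w[f] / ‖f‖²`. [folklore] -/
theorem IsCore.periodicEnergy_toTrialState (w : ℝ → ℝ≥0∞) {f : Config M → ℂ} (hf : IsCore L f)
    (h0 : normSq L f ≠ 0) (htop : normSq L f ≠ ⊤) :
    periodicEnergy w (hf.toTrialState h0 htop) = (normSq L f)⁻¹ * qform w L f := by
  have hpos : 0 < (normSq L f).toReal := ENNReal.toReal_pos h0 htop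
  have hc2 : ((‖((Real.sqrt (normSq L f).toReal)⁻¹ : ℂ)‖₊ : ℝ≥0∞)) ^ 2 = (normSq L f)⁻¹ := by
    rw [coe_nnnorm_sq_eq_ofReal, norm_inv, Complex.norm_real,
      Real.norm_of_nonneg (Real.sqrt_nonneg _), inv_pow, Real.sq_sqrt hpos.le,
      ENNReal.ofReal_inv_of_pos hpos, ENNReal.ofReal_toReal htop]
  rw [periodicEnergy_eq_qform, hf.toTrialState_ψ h0 htop,
    qform_const_mul w L _ (hf.contDiff.differentiable one_ne_zero), hc2]

/-- **Normalisation step.** If `E ≤ ⟨Ψ, HΨ⟩` for the normalised state `Ψ = f/‖f‖` of a core `f`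
(whenever `0 < ‖f‖² < ∞`), then `E · ‖f‖² ≤ 𝓔_w[f]` (trivial if `‖f‖² = 0`; `‖f‖² < ∞` always). [folklore] -/
theorem mul_normSq_le_qform_of_forall_le (w : ℝ → ℝ≥0∞) {f : Config M → ℂ} (hf : IsCore L f)
    {E : ℝ≥0∞} (hE : ∀ (h0 : normSq L f ≠ 0) (htop : normSq L f ≠ ⊤),
      E ≤ periodicEnergy w (hf.toTrialState h0 htop)) :
    E * normSq L f ≤ qform w L f := by
  have htop : normSq L f ≠ ⊤ := (normSq_lt_top L hf.contDiff.continuous).ne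
  rcases eq_or_ne (normSq L f) 0 with h0 | h0
  · rw [h0, mul_zero]
    exact zero_le
  calc E * normSq L f ≤ periodicEnergy w (hf.toTrialState h0 htop) * normSq L f :=
        mul_le_mul_left (hE h0 htop) _
    _ = qform w L f := by
        rw [hf.periodicEnergy_toTrialState w h0 htop, mul_comm _⁻¹, mul_assoc,
          ENNReal.inv_mul_cancel h0 htop, mul_one]

/-! ## A1, A2, A3 -/

/-- **A1 (variational principle, unnormalised)**: `E₀(M,L) · ‖f‖² ≤ 𝓔_w[f]` for every core `f`
(`C¹`, periodic, Bose-symmetric, not necessarily normalised): the tree's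
`BoseGas.periodicGroundStateEnergy_mul_normSq_le` (normalise `f/‖f‖` when `0 < ‖f‖² < ∞`; `‖f‖² = 0`
is trivial, `‖f‖² = ⊤` impossible). The hypotheses `0 < L`, `Measurable w` are not used.
[cite: Fournais2020, (1.1)–(1.2)] -/
theorem groundStateEnergy_mul_normSq_le (_hL : 0 < L) {w : ℝ → ℝ≥0∞} (_hw : Measurable w)
    {f : Config M → ℂ} (hf : IsCore L f) :
    periodicGroundStateEnergy w M L * normSq L f ≤ qform w L f :=
  periodicGroundStateEnergy_mul_normSq_le w hf.contDiff hf.periodic hf.symm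

/-- **A2 (sector variational principle, unnormalised)**: `E_M(q) · ‖f‖² ≤ 𝓔_w[f]` for every core `f`
of total momentum `q` (`IsCore.toTrialState` = `PeriodicTrialState.ofFun`, `HasTotalMomentum.ofFun`,
`momentumSectorEnergy_le`, and the scaling `mul_normSq_le_qform_of_forall_le`). The hypothesis `0 < L`
is not used. [cite: CorneanDerezinskiZin2009, §1.1 (1.6)] -/
theorem momentumSectorEnergy_mul_normSq_le (_hL : 0 < L) (w : ℝ → ℝ≥0∞) {q : Space}
    {f : Config M → ℂ} (hf : IsCore L f) (hq : HasTotalMomentum q f) :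
    momentumSectorEnergy w M L q * normSq L f ≤ qform w L f :=
  mul_normSq_le_qform_of_forall_le w hf fun h0 htop =>
    momentumSectorEnergy_le w _ (hq.ofFun hf.contDiff hf.periodic hf.symm h0 htop)

/-- **A3 (monotonicity in the particle number)**: `E₀(M, L) ≤ E₀(M+1, L)` for a measurable repulsive
`w` (freeze particle `0`: for every `(M+1)`-body state `Ψ` and every `x₀` the slice `Y ↦ Ψ(x₀, Y)` is an
unnormalised `M`-body core, so `E₀(M) · ∫|Ψ(x₀,·)|² ≤ ∫ (∑_{j≥1}|∇ⱼΨ|² + ∑_{1≤i<j} w^per |Ψ|²)(x₀,·)`;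
integrate over `x₀ ∈ [0,L)³` (Tonelli) and drop `|∇₀Ψ|² ≥ 0` and the pairs through particle `0` —
in the tree: `periodicGroundStateEnergy_le_coupledGroundStateEnergy_zero` then
`coupledGroundStateEnergy_le_periodic` at coupling `λ = 0`). The hypothesis `0 < L` is not used
(for `L ≤ 0` there are no `(M+1)`-body states and the right-hand side is `⊤`). [folklore] -/
theorem periodicGroundStateEnergy_le_succ (_hL : 0 < L) {w : ℝ → ℝ≥0∞} (hw : Measurable w) (M : ℕ) :
    periodicGroundStateEnergy w M L ≤ periodicGroundStateEnergy w (M + 1) L :=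
  (periodicGroundStateEnergy_le_coupledGroundStateEnergy_zero hw M L).trans
    (coupledGroundStateEnergy_le_periodic w 0 M L)

end Summit.AtomisticToContinuum.BoseEinsteinCondensation.Cruxes.PeriodicIRBound.LinearPhFloorWagner.WF

end

/-!

(line `linear-ph-floor-wagner`, crux stmt-AtomisticToContinuum-3972):

* `sqrt_normSq_add_le` (H1): Minkowski's inequality for the `L²`-type form
  `normSq L f = ∫_{[0,L)^{3M}} |f|²` on the cell, `‖f + g‖ ≤ ‖f‖ + ‖g‖`, and its squared form
  `normSq_add_le_sq` (`ENNReal.lintegral_Lp_add_le` with `p = 2` for `X ↦ ‖f X‖₊`, `X ↦ ‖g X‖₊`).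
* `wf_real_core` (H3): the real-arithmetic core of the Wagner–Feynman chain (linear arithmetic in
  the products `e₁ν, e₃ν, e₃nΦ, e₀ν, e₀nΦ, DnΦ, θν, √δ√K`).
* `exists_slack` (H4): the choice of the slack `δ₀`, by continuity at `δ = 0` of
  `δ ↦ (√((D + δ + 2√δ√K)/θ) + √(cδ))²`, whose value at `0` is `D/θ < (D + ε)/θ`.
* `ennreal_le_of_forall_pos`: `a ≤ ofReal (d + ε)` for all `ε > 0` implies `a ≤ ofReal d`
  (`ENNReal.le_of_forall_pos_le_add`).

Design: the statements are those of the brief, verbatim up to binder names: the hypotheses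
`0 ≤ θ`, `0 ≤ δ`, `0 ≤ K`, `0 ≤ e0` of `wf_real_core` and `0 ≤ K`, `0 ≤ c` of `exists_slack` are not
needed by the proofs (`Real.sqrt` is total); they are kept, with binder names `_hθ`, `_hδ`, `_hK`,
`_he0`, `_hK`, `_hc`, so that the positional signatures are unchanged.
-/

noncomputable section

open scoped BigOperators ENNReal ComplexConjugate
open Filter MeasureTheory

namespace Summit.AtomisticToContinuum.BoseEinsteinCondensation.Cruxes.PeriodicIRBound.LinearPhFloorWagner.WF

open Literature.MathematicalPhysics.QuantumManyBody.BoseGas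

variable {M : ℕ} {L : ℝ}

/-! ## H1: Minkowski's inequality for `normSq` -/

/-- H1 (Minkowski for `normSq` on the cell): `‖f + g‖ ≤ ‖f‖ + ‖g‖` for the `L²([0,L)^{3M})` seminorm
`‖f‖ = (normSq L f)^{1/2}` of measurable `f g : Config M → ℂ`. [folklore] -/
theorem sqrt_normSq_add_le (L : ℝ) {M : ℕ} {f g : Config M → ℂ} (hf : Measurable f) (hg : Measurable g) :
    (normSq L (fun X => f X + g X)) ^ (1 / 2 : ℝ) ≤
      (normSq L f) ^ (1 / 2 : ℝ) + (normSq L g) ^ (1 / 2 : ℝ) := by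
  have key := ENNReal.lintegral_Lp_add_le (μ := volume.restrict (cellN M L)) (p := (2 : ℝ))
    (f := fun X => (‖f X‖₊ : ℝ≥0∞)) (g := fun X => (‖g X‖₊ : ℝ≥0∞))
    hf.nnnorm.coe_nnreal_ennreal.aemeasurable hg.nnnorm.coe_nnreal_ennreal.aemeasurable one_le_two
  simp only [Pi.add_apply, ENNReal.rpow_two] at key
  refine le_trans ?_ key
  refine ENNReal.rpow_le_rpow (lintegral_mono fun X => ?_) (by norm_num)
  gcongr
  exact_mod_cast nnnorm_add_le (f X) (g X)

/-- H1, squared form: `‖f + g‖² ≤ (‖f‖ + ‖g‖)²` for the `L²([0,L)^{3M})` seminorm of measurable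
`f g : Config M → ℂ`. [folklore] -/
theorem normSq_add_le_sq (L : ℝ) {M : ℕ} {f g : Config M → ℂ} (hf : Measurable f) (hg : Measurable g) :
    normSq L (fun X => f X + g X) ≤ ((normSq L f) ^ (1 / 2 : ℝ) + (normSq L g) ^ (1 / 2 : ℝ)) ^ (2 : ℝ) := by
  have h := ENNReal.rpow_le_rpow (z := (2 : ℝ)) (sqrt_normSq_add_le L hf hg) (by norm_num)
  rwa [← ENNReal.rpow_mul, show (1 / 2 : ℝ) * 2 = 1 by norm_num, ENNReal.rpow_one] at h

/-! ## H3: the real-arithmetic core -/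

/-- H3 (the real-arithmetic core of the Wagner–Feynman chain): from the two sector bounds, the form
inequality, the cross-term control, near-minimality, the particle–hole floor hypothesis and the
monotonicity `e₀ ≤ e₃`, deduce `θν ≤ D + δ + 2√δ√K`. [folklore] -/
theorem wf_real_core {e0 e1 e3 θ ν nΦ qa qc q B D δ K : ℝ}
    (hν : 0 ≤ ν) (hnΦ : 0 ≤ nΦ) (hnΦ1 : nΦ ≤ 1) (_hθ : 0 ≤ θ) (_hδ : 0 ≤ δ) (_hK : 0 ≤ K) (hD : 0 ≤ D)
    (_he0 : 0 ≤ e0)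
    (h1 : e1 * ν ≤ qa)
    (h2 : e3 * (nΦ + ν) ≤ qc)
    (h3 : qa + qc ≤ D * nΦ + q + 2 * B)
    (h4 : |B - e0 * ν| ≤ Real.sqrt δ * Real.sqrt K)
    (h5 : q ≤ e0 * nΦ + δ)
    (h6 : 2 * e0 + θ ≤ e3 + e1)
    (h7 : e0 ≤ e3) :
    θ * ν ≤ D + δ + 2 * (Real.sqrt δ * Real.sqrt K) := by
  have hA : (2 * e0 + θ) * ν ≤ (e3 + e1) * ν := mul_le_mul_of_nonneg_right h6 hν
  have hB : e0 * nΦ ≤ e3 * nΦ := mul_le_mul_of_nonneg_right h7 hnΦ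
  have hC : D * nΦ ≤ D := mul_le_of_le_one_right hD hnΦ1
  have hB' : B - e0 * ν ≤ Real.sqrt δ * Real.sqrt K := (abs_le.mp h4).2
  nlinarith [hA, hB, hC, hB', h1, h2, h3, h5]

/-! ## H4: the choice of the slack -/

/-- H4 (choice of the slack): for `θ, ε > 0` there is `δ₀ > 0` such that
`(√((D + δ + 2√δ√K)/θ) + √(cδ))² ≤ (D + ε)/θ` for all `0 < δ ≤ δ₀` (continuity at `δ = 0`, where the
left side equals `D/θ < (D + ε)/θ`). [folklore] -/
theorem exists_slack {D θ ε K c : ℝ} (hD : 0 ≤ D) (hθ : 0 < θ) (hε : 0 < ε) (_hK : 0 ≤ K) (_hc : 0 ≤ c) :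
    ∃ δ₀ : ℝ, 0 < δ₀ ∧ ∀ δ : ℝ, 0 < δ → δ ≤ δ₀ →
      (Real.sqrt ((D + δ + 2 * (Real.sqrt δ * Real.sqrt K)) / θ) + Real.sqrt (c * δ)) ^ 2 ≤ (D + ε) / θ := by
  set F : ℝ → ℝ := fun δ =>
    (Real.sqrt ((D + δ + 2 * (Real.sqrt δ * Real.sqrt K)) / θ) + Real.sqrt (c * δ)) ^ 2 with hF
  have hcont : Continuous F := by
    rw [hF]
    fun_prop
  have hF0 : F 0 = D / θ := by
    simp only [hF, Real.sqrt_zero, zero_mul, mul_zero, add_zero]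
    exact Real.sq_sqrt (div_nonneg hD hθ.le)
  have hlt : F 0 < (D + ε) / θ := by
    rw [hF0]
    exact div_lt_div_of_pos_right (by linarith) hθ
  have hev : ∀ᶠ δ in nhds (0 : ℝ), F δ < (D + ε) / θ :=
    (hcont.tendsto 0).eventually_lt_const hlt
  obtain ⟨r, hr, hrF⟩ := Metric.eventually_nhds_iff.mp hev
  refine ⟨r / 2, by positivity, fun δ hδ hδr => le_of_lt ?_⟩
  have hdist : dist δ 0 < r := by
    rw [Real.dist_eq, sub_zero, abs_of_pos hδ]
    linarith
  exact hrF hdist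

/-! ## An `ℝ≥0∞` approximation fact -/

/-- If `a ≤ ofReal (d + ε)` for every `ε > 0` (with `d ≥ 0`), then `a ≤ ofReal d`. [folklore] -/
theorem ennreal_le_of_forall_pos {a : ℝ≥0∞} {d : ℝ} (hd : 0 ≤ d)
    (h : ∀ ε : ℝ, 0 < ε → a ≤ ENNReal.ofReal (d + ε)) : a ≤ ENNReal.ofReal d := by
  refine ENNReal.le_of_forall_pos_le_add fun ε hε _ => ?_
  calc a ≤ ENNReal.ofReal (d + ε) := h ε (by exact_mod_cast hε)
    _ = ENNReal.ofReal d + ε := by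
      rw [ENNReal.ofReal_add hd ε.coe_nonneg, ENNReal.ofReal_coe_nnreal]

end Summit.AtomisticToContinuum.BoseEinsteinCondensation.Cruxes.PeriodicIRBound.LinearPhFloorWagner.WF

end

namespace Summit.AtomisticToContinuum.BoseEinsteinCondensation.Cruxes.PeriodicIRBound.LinearPhFloorWagner

/-- The registered sub-goal `stub_wfVariational` of the crux ledger: this file's headline lemma `WF.groundStateEnergy_mul_normSq_le`. -/
theorem stub_wfVariational : WF.Pkg.Variational :=
  @WF.groundStateEnergy_mul_normSq_le

end Summit.AtomisticToContinuum.BoseEinsteinCondensation.Cruxes.PeriodicIRBound.LinearPhFloorWagner
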